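import Summits.CriticalPhenomena.PercolationContinuityZ3.Theses.PercNonProliferation
import Summits.CriticalPhenomena.PercolationContinuityZ3.Theorems.NonProliferation.Negative.AboveSix
import Literature.Barriers.CriticalPhenomena.SpanningClustersAboveSix
import Literature.Probability.Percolation.RussoFormula
import HarnessLib

/-!
# Crux `PercNonProliferation.NonProliferation` (stmt-CriticalPhenomena-4444), line `birth-merge-ledger` — stub `stub_anchor`

Helper file for the lead's skeleton of line `birth-merge-ledger`
(`Cruxes/NonProliferation/Lines/birth_merge_ledger.lean`, prover-line-stmt-CriticalPhenomena-4444-0).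
Proves exactly the registered stub signature `stub_anchor`; lands with `--supports stmt-CriticalPhenomena-4444`.

The anchor `t = 0` of the birth–merge ledger: at edge density `p = projIcc 0 1 _ 0 = 0` the
percolation measure is the Dirac mass at the empty configuration (`setBernoulli_zero`, as in
`theta_bot`), in which the open graph has no edges, so `{x ↔ y in S}` forces `x = y`
(`StubAnchor.eq_of_empty_mem_openConnIn`). A representative of `repEvent d k n` or a crossing of
`annulusCrossing d n` would then be a point of `B(n) ∩ ∂ⁱⁿB(2n)`, which is empty for `n ≥ 1`
(`StubAnchor.not_mem_innerBoundary_of_mem_box`: a neighbour `x ± eᵢ` of a point of `B(n)` has all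
coordinates of modulus `≤ n + 1 ≤ 2n`). Hence both probabilities vanish.
-/

noncomputable section

namespace Summit.CriticalPhenomena.PercolationContinuityZ3.Theorems.NonProliferation

open MeasureTheory Filter Topology
open Literature.Probability.LatticeModels Literature.Probability.Percolation
open Literature.Barriers.CriticalPhenomena
open Summit.CriticalPhenomena.PercolationContinuityZ3.Theorems.NonProliferation.Negative

namespace StubAnchor

/-- In the empty configuration the open graph has no edges, so `∅ ∈ {x ↔ y in S}` forces `x = y`. -/
theorem eq_of_empty_mem_openConnIn {V : Type*} {S : Set V} {x y : V}
    (h : (∅ : BondConfig V) ∈ openConnIn S x y) : x = y := by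
  obtain ⟨hx, hy, ⟨w⟩⟩ := h
  cases w with
  | nil => rfl
  | cons hadj _ =>
    exact absurd hadj (by simp [SimpleGraph.comap_adj, openGraph_adj])

/-- For `n ≥ 1`, no point of the inner box `B(n)` lies on the inner vertex boundary of `B(2n)`:
a lattice neighbour `x ± eᵢ` of `x ∈ B(n)` has coordinates of modulus `≤ n + 1 ≤ 2n`. -/
theorem not_mem_innerBoundary_of_mem_box {d n : ℕ} (hn : 1 ≤ n) {x : Site d}
    (hx : x ∈ box d n) : x ∉ innerBoundary (zdGraph d) (box d (2 * n)) := by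
  rw [mem_innerBoundary_iff]
  rintro ⟨-, z, hz, hadj⟩
  apply hz
  rw [mem_box] at hx ⊢
  intro i
  have hxi := hx i
  rcases (zdGraph_adj_iff x z).1 hadj with ⟨j, hz' | hz'⟩
  · have hzi : z i = x i + (Pi.single j (1 : ℤ) : Site d) i := by rw [hz']; rfl
    rcases eq_or_ne i j with rfl | hij
    · rw [Pi.single_eq_same] at hzi
      push_cast
      omega
    · rw [Pi.single_eq_of_ne hij, add_zero] at hzi
      push_cast
      omega
  · have hzi : x i = z i + (Pi.single j (1 : ℤ) : Site d) i := by rw [hz']; rfl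
    rcases eq_or_ne i j with rfl | hij
    · rw [Pi.single_eq_same] at hzi
      push_cast
      omega
    · rw [Pi.single_eq_of_ne hij, add_zero] at hzi
      push_cast
      omega

/-- At `p = 0` the percolation measure is `dirac ∅`, so an event avoiding the empty configuration
has probability `0` (cf. `theta_bot`). -/
theorem real_zero_of_empty_notMem {d : ℕ} {A : Set (BondConfig (Site d))}
    (hA : (∅ : BondConfig (Site d)) ∉ A) : (bondPercolation (zdGraph d) 0).real A = 0 := by
  simp only [bondPercolation, ProbabilityTheory.setBernoulli_zero, measureReal_def,
    Measure.dirac_apply, Set.indicator_of_notMem hA, ENNReal.toReal_zero]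

/-- For `n ≥ 1` the empty configuration has no annulus-crossing representative:
`∅ ∉ repEvent d k n`. -/
theorem empty_notMem_repEvent {d n : ℕ} (hn : 1 ≤ n) (k : ℕ) :
    (∅ : BondConfig (Site d)) ∉ repEvent d k n := by
  rintro ⟨x, hx, hconn, -⟩
  obtain ⟨y, hy, hxy⟩ := hconn 0
  rw [← eq_of_empty_mem_openConnIn hxy] at hy
  exact not_mem_innerBoundary_of_mem_box hn (hx 0) hy

/-- For `n ≥ 1` the empty configuration has no annulus crossing: `∅ ∉ annulusCrossing d n`. -/
theorem empty_notMem_annulusCrossing {d n : ℕ} (hn : 1 ≤ n) :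
    (∅ : BondConfig (Site d)) ∉ annulusCrossing d n := by
  rintro ⟨x, hx, y, hy, hxy⟩
  rw [← eq_of_empty_mem_openConnIn hxy] at hy
  exact not_mem_innerBoundary_of_mem_box hn hx hy

end StubAnchor

/-- **Stub `stub_anchor`** of line `birth-merge-ledger` (crux stmt-CriticalPhenomena-4444): the trivial
anchor `t = 0` of the ledger. At density `projIcc 0 1 _ 0 = 0` every edge is closed
(`P_0 = dirac ∅`), and for `n ≥ 1` the empty configuration lies neither in `repEvent d k n` nor in
`annulusCrossing d n` (a representative/crossing would be a point of `B(n) ∩ ∂ⁱⁿB(2n) = ∅`), so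
`P_0(repEvent d k n) = 0` for every `k` and `P_0(annulusCrossing d n) = 0`. -/
theorem stub_anchor :
    ∀ (d n : ℕ), 1 ≤ n → (∀ k : ℕ, (bondPercolation (zdGraph d) (Set.projIcc (0 : ℝ) 1 zero_le_one 0)).real (repEvent d k n) = 0) ∧ (bondPercolation (zdGraph d) (Set.projIcc (0 : ℝ) 1 zero_le_one 0)).real (annulusCrossing d n) = 0 := by
  intro d n hn
  have hp : Set.projIcc (0 : ℝ) 1 zero_le_one 0 = 0 := Set.projIcc_left _
  rw [hp]
  exact ⟨fun k => StubAnchor.real_zero_of_empty_notMem (StubAnchor.empty_notMem_repEvent hn k),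
    StubAnchor.real_zero_of_empty_notMem (StubAnchor.empty_notMem_annulusCrossing hn)⟩

end Summit.CriticalPhenomena.PercolationContinuityZ3.Theorems.NonProliferation

end
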